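import Literature.NumberTheory.EllipticCurves.EmertonPollackWeston2006.WeightKMembersOddPrime
import Literature.NumberTheory.EllipticCurves.Wan2015RationalMainConjecture
import Summits.BirchSwinnertonDyer.Rank1Residual.X11a.MuLambdaSplit
import HarnessLib

/-!
# Crux `X11aLowerHalf` (item stmt-BirchSwinnertonDyer-19064), odd primes — the TWO per-pair inputs of the
# Hida-family chain as named predicates: the rational cyclotomic equality at a member of `H(E[p])`
# (`RatEqAtMember`, X. Wan's Thm. 4 conclusion shape) and «a good-ordinary member with that equality»
# (`MemberRatEqAt`) (DEFINITIONS ONLY; seat bsd-line-er5-p2 = -w3 width seat of the 19064 line)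

DEFINITIONS ONLY (two `Prop`-valued predicates + three proved unfolding/bookkeeping lemmas; nothing is asserted
about any curve, form or prime; no named fact; no `sorry`). Filed as a tree module so that (i) the line's lead can
state a registered stub for the `p = 3` part of the crux with a ONE-LINE signature
(`∀ W p, ClassX11a W p → p = 3 → ¬ X11a.ShaAnUnit W p → MemberRatEqAt W p`, his call) and (ii) the closers
(`Theorems/PrintX11aLowerHalfOddPrimeChain.lean` p614124, `…OddPrimeDoors.lean`) can be restated BY NAME.

The objects:
* `RatEqAtMember p g ι` — for a newform `g ∈ S_k(Γ₀(M))` with a `p`-adic embedding `ι` of its coefficient field: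
  «`char_Λ X(ℚ_∞, A_g) = (L_p(g))` in `Λ_𝒪 ⊗ ℚ_p`» in the tree's GL₂ vocabulary — for all ordinary `p`-adic data
  `𝔇` of `(g, ι)`, all cyclotomic data `(κ, γ)`, every torsion `Λ_𝒪`-dual datum `D` of Greenberg's `Sel(ℚ_∞, A_g)`
  with a principal generator `G`, every Shimura period–symbol datum and THE bounded cyclotomic `p`-adic
  `L`-function `L` of `(g, ι, υ)`: `L = c · (u · G)` with `c ∈ ℚ̄_pˣ`, `u ∈ Λ_𝒪ˣ`. VERBATIM the conclusion block
  of the Literature fact `Wan2015.thm4_rational_weightK_member_of_bdd_ofLevel_irred` (X. Wan, Forum Math.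
  Sigma 3 (2015) e18, Thm. 4 = Thm. 103 — PRINTED under "Suppose that `p ⩾ 5`", p. 4), read at ONE member;
  `ratEqAtMember_of_wan` below shows that fact gives it for every member at `p ≥ 5`.
* `MemberRatEqAt W p` — «some good-ordinary member `(g, ι)` of `H(E[p])` (some level `M` with `p ∤ M`, some
  weight) satisfies `RatEqAtMember p g ι`»: the second component of the per-pair input of the odd-prime chain
  (the first is the certificate `X11a.MuAnZeroAt W p`). At `p ≥ 5` with `p ∥ N` and `E[p]` irreducible it
  FOLLOWS from Wan's fact and the modularity-produced member; at `p = 3` it has no printed source (the `p = 3`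
  residual of the crux; Skinner–Urban's Thm. 3.6.4 would give it for a member whose level has a prime `q ∥ M` at
  which `E[3]` ramifies).

HONEST FRAMING: predicates only; `MemberRatEqAt W 3` on the deep X11a locus is NOT in print and nothing here claims
it; beyond-print theorem: no. BSD is not proved by any of this.

References: [Wan2015] Thm. 4 (p. 4) = Thm. 103 (pp. 91–92); [EmertonPollackWeston2006] Intro p. 2 (H(ρ̄)), §2.1,
Thm. 5.1.3; [SkinnerUrban2014] Thm. 3.6.4 (reading only); cell files `pub/bsd-stepL/line-er5-p2/P3-LOWER-AUDIT.md`.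
-/

noncomputable section

open scoped Classical MatrixGroups ModularForm
open CongruenceSubgroup
open Literature.NumberTheory.EllipticCurves Literature.NumberTheory.EllipticCurves.ModularForms
  Literature.NumberTheory.EllipticCurves.EmertonPollackWeston2006
  Literature.NumberTheory.GaloisRepresentations

-- the summit and its single problem are both named `BirchSwinnertonDyer` (registry layout D-0017)
set_option linter.dupNamespace false
set_option autoImplicit false

namespace Summit.BirchSwinnertonDyer.BirchSwinnertonDyer.Theorems.OddChain

/-- **The rational cyclotomic equality at a member** — X. Wan's Thm. 4 conclusion shape at ONE `p`-adically
embedded newform `(g, ι)` of level `Γ₀(M)`: for all ordinary `p`-adic data, cyclotomic data, torsion dual data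
`D` with principal generator `G`, Shimura data and THE bounded cyclotomic `p`-adic `L`-function `L`:
`L = c · (u · G)`, `c ≠ 0`, `u` a unit of `Λ_𝒪` («`char_Λ X(ℚ_∞, A_g) = (L_p(g))` in `Λ_𝒪 ⊗ ℚ_p`»). Verbatim the
conclusion block of `Wan2015.thm4_rational_weightK_member_of_bdd_ofLevel_irred`. A predicate; nothing asserted.
[cite: Wan2015, Thm. 4 (pp. 4–5) = Thm. 103 (pp. 91–92) (conclusion shape only; nothing asserted)]
[cite: SkinnerUrban2014, Thm. 1 (p. 2) = Thm. 3.6.4 (shape of the rational equality; nothing asserted)] -/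
def RatEqAtMember (p : ℕ) [Fact p.Prime] {M : ℕ} {k : ℤ} (g : CuspForm (Gamma0 M) k)
    (ι : coeffField g →+* PadicAlgCl p) : Prop :=
  ∀ (𝔇 : OrdinaryPadicData g p ι) (κ : ZpExtension ℚ p) (γ : Field.absoluteGaloisGroup ℚ),
      κ.IsCyclotomic → κ.IsTopGenerator γ → IsCyclotomicVariable p γ →
    ∀ (D : GreenbergSelmer.DualData (padicCoeffField (memberGenerators g ι 𝔇.υ)) κ γ 𝔇.ρ 𝔇.plus),
      Module.IsTorsion (PowerSeries (padicCoeffIntegers (memberGenerators g ι 𝔇.υ))) D.X →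
    ∀ G : PowerSeries (padicCoeffIntegers (memberGenerators g ι 𝔇.υ)),
      D.charIdeal = Ideal.span {G} →
    ∀ (Dsym : PeriodSymbolDatum g) (L : PowerSeries (PadicAlgCl p)),
      IsCycPAdicLFunctionWeightK g Dsym p ι 𝔇.υ L →
      (∃ C : ℝ, ∀ i, ‖PowerSeries.coeff i L‖ ≤ C) →
      ∃ (c : PadicAlgCl p) (u : (PowerSeries (padicCoeffIntegers (memberGenerators g ι 𝔇.υ)))ˣ),
        c ≠ 0 ∧
          L = PowerSeries.C c *
            PowerSeries.map (padicCoeffIntegers (memberGenerators g ι 𝔇.υ)).subtype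
              ((u : PowerSeries (padicCoeffIntegers (memberGenerators g ι 𝔇.υ))) * G)

/-- **«A good-ordinary member of `H(E[p])` with the rational cyclotomic equality»** at the pair `(W, p)`:
some level `M` with `p ∤ M`, some weight `k`, a newform `g ∈ S_k(Γ₀(M))` and `ι` with
`IsOrdinaryMemberOfLevel W p g ι` (congruent to `f_E` at all `ℓ ∤ N`, `p`-ordinary, `k > 2`,
`k ≡ 2 (mod p − 1)`) and `RatEqAtMember p g ι`. The per-pair input of the odd-prime chain besides the
certificate `μ^an(E,p) = 0`; at `p ≥ 5` a consequence of Wan's fact (`memberRatEqAt_of_wan_of_five_le` in the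
closer), at `p = 3` not in print. A predicate; nothing asserted.
[cite: EmertonPollackWeston2006, Intro p. 2 (H(ρ̄)) and §2.1 (shape only; nothing asserted)]
[cite: Wan2015, Thm. 4 (pp. 4–5) (shape only; nothing asserted)] -/
def MemberRatEqAt (W : WeierstrassCurve ℚ) [W.IsElliptic] [W.IsGloballyMinimal] (p : ℕ) [Fact p.Prime] :
    Prop :=
  ∃ (M : ℕ) (_ : NeZero M) (_ : ¬ p ∣ M) (k : ℤ) (g : CuspForm (Gamma0 M) k)
    (ι : coeffField g →+* PadicAlgCl p), IsOrdinaryMemberOfLevel W p g ι ∧ RatEqAtMember p g ι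

/-! ### Bookkeeping (proved) -/

/-- Unfolding of `RatEqAtMember` (definitional). [folklore] -/
theorem ratEqAtMember_iff (p : ℕ) [Fact p.Prime] {M : ℕ} {k : ℤ} (g : CuspForm (Gamma0 M) k)
    (ι : coeffField g →+* PadicAlgCl p) :
    RatEqAtMember p g ι ↔
    ∀ (𝔇 : OrdinaryPadicData g p ι) (κ : ZpExtension ℚ p) (γ : Field.absoluteGaloisGroup ℚ),
      κ.IsCyclotomic → κ.IsTopGenerator γ → IsCyclotomicVariable p γ →
    ∀ (D : GreenbergSelmer.DualData (padicCoeffField (memberGenerators g ι 𝔇.υ)) κ γ 𝔇.ρ 𝔇.plus),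
      Module.IsTorsion (PowerSeries (padicCoeffIntegers (memberGenerators g ι 𝔇.υ))) D.X →
    ∀ G : PowerSeries (padicCoeffIntegers (memberGenerators g ι 𝔇.υ)),
      D.charIdeal = Ideal.span {G} →
    ∀ (Dsym : PeriodSymbolDatum g) (L : PowerSeries (PadicAlgCl p)),
      IsCycPAdicLFunctionWeightK g Dsym p ι 𝔇.υ L →
      (∃ C : ℝ, ∀ i, ‖PowerSeries.coeff i L‖ ≤ C) →
      ∃ (c : PadicAlgCl p) (u : (PowerSeries (padicCoeffIntegers (memberGenerators g ι 𝔇.υ)))ˣ),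
        c ≠ 0 ∧
          L = PowerSeries.C c *
            PowerSeries.map (padicCoeffIntegers (memberGenerators g ι 𝔇.υ)).subtype
              ((u : PowerSeries (padicCoeffIntegers (memberGenerators g ι 𝔇.υ))) * G) :=
  Iff.rfl

/-- Unfolding of `MemberRatEqAt` (definitional). [folklore] -/
theorem memberRatEqAt_iff (W : WeierstrassCurve ℚ) [W.IsElliptic] [W.IsGloballyMinimal] (p : ℕ)
    [Fact p.Prime] :
    MemberRatEqAt W p ↔
    ∃ (M : ℕ) (_ : NeZero M) (_ : ¬ p ∣ M) (k : ℤ) (g : CuspForm (Gamma0 M) k)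
      (ι : coeffField g →+* PadicAlgCl p), IsOrdinaryMemberOfLevel W p g ι ∧ RatEqAtMember p g ι :=
  Iff.rfl

/-- **Wan's fact (irred instance, `p ≥ 5`) gives `RatEqAtMember` at EVERY ordinary member of `H(E[p])`**
(`E[p]` irreducible, `p ∥ N`, `5 ≤ p`; the fact's conclusion block IS the predicate's body).
[cite: Wan2015, Thm. 4 (pp. 4–5) = Thm. 103 (pp. 91–92)] -/
theorem ratEqAtMember_of_wan (hT2 : Wan2015.thm4_rational_weightK_member_of_bdd_ofLevel_irred)
    (W : WeierstrassCurve ℚ) [W.IsElliptic] [W.IsGloballyMinimal] (p : ℕ) [Fact p.Prime] (hp : 5 ≤ p)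
    (hmult : W.HasMultiplicativeReductionAtPrime p) (hirr : W.HasIrreducibleModPGaloisRep p)
    {M : ℕ} [NeZero M] (hpM : ¬ p ∣ M) {k : ℤ} (g : CuspForm (Gamma0 M) k)
    (ι : coeffField g →+* PadicAlgCl p) (hmem : IsOrdinaryMemberOfLevel W p g ι) :
    RatEqAtMember p g ι :=
  fun 𝔇 κ γ hκ hγ hγ' D htors G hG Dsym L hL hbd =>
    hT2 W p hp hmult hirr hpM g ι hmem 𝔇 κ γ hκ hγ hγ' D htors G hG Dsym L hL hbd

end Summit.BirchSwinnertonDyer.BirchSwinnertonDyer.Theorems.OddChain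

end
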